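import Mathlib
import HarnessLib

/-!
# Route `KLProgramme` — crux C4a, S3 (B4)-GENERIC — MONOTONE-WINDOW CALCULUS, part 1 («(B4)-GEN-WINDOW», carrier-free JETS):
# exact Leibniz formula for derivative families on an OPEN WINDOW, and the reciprocal-slope jets `(1/h)^{(k)}` from the
# implicit relation `(1/h)·h ≡ 1`

Cell `gate-hubbard-kl`, seat hubbard-kl-k3c3-p3 (g20; row «implicit-function / monotonicity route»).  Located brick for the (C)-closer lane c4a-1
(stub (C) `stub_twoLeg_curvature` of `KLRegimeEngineV17F2`, stmt-HubbardSuperconductivity-20437), C4A-PLAN §24.4 (iii) / §24.6 (B4) / §24.10: the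
generic-region estimate of the co-moving bubble integrates by parts in the loop angle `φ` on the WINDOWS where the partner band has a slope floor
`|∂_φ ē| ≥ m`; the operator is `w ↦ (w/∂_φē)′` (`…C4aLoopIBPDefs.loopIBPOp`), whose iterates involve the jets of the reciprocal slope `1/∂_φē`
— an object that is smooth ONLY on the window.  Everything here is therefore local to an open set `U ⊆ ℝ`:

* `hasDerivAt_iteratedDeriv_of_contDiffAt` / `_of_contDiffOn` — the chain `(f^{(m)})′ = f^{(m+1)}` AT a point from `C^N` near it (`m < N`);
* **`leibniz_family_on`** — for families `A k, B k, P k : ℝ → ℝ` with `(A k)′ = A (k+1)`, `(B k)′ = B (k+1)`, `(P k)′ = P (k+1)` on `U` (`k < N`) and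
  `P 0 = A 0 · B 0` on `U`:  `P k = Σ_{j ≤ k} C(k,j) · A j · B (k−j)` on `U` for every `k ≤ N` (derivative uniqueness + Pascal, no `iteratedDeriv` API);
* **`iteratedDeriv_mul_eq_sum_on`**, `abs_iteratedDeriv_mul_le_on` — the exact / absolute Leibniz formula for `f·g` with `f, g ∈ C^N(U)`, `k ≤ N`;
* **`sum_choose_iteratedDeriv_inv_mul_eq_zero_on`** — `h ∈ C^N(U)` nonvanishing: `Σ_{j ≤ k} C(k,j) · (1/h)^{(j)} · h^{(k−j)} = 0` on `U`
  (`1 ≤ k ≤ N`): the implicit relation `(1/h)·h ≡ 1` differentiated `k` times;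
* **`abs_iteratedDeriv_inv_le_of_table`** — solving that relation for the top term: `m ≤ |h|`, `|h^{(l)}| ≤ Hb l` (`1 ≤ l ≤ N`) and any table `R` with
  `m⁻¹ ≤ R 0`, `m⁻¹ · Σ_{j<k} C(k,j) · R j · Hb (k−j) ≤ R k` give `|(1/h)^{(k)}| ≤ R k` on `U` (`k ≤ N`) — instantiated at `R = recipSlopeJet` in
  `…C4aLoopIBPBounds`.

Mathlib-only; no definitions, no instances; nothing is asserted about the Hubbard model.  The chain lemma is adapted from
`Summits/QuantumFields/BalabanUV/Beta/FP/InverseSymbolDerivN` (same folklore statement, re-proved here to keep the lane's imports inside the summit);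
the Leibniz-by-uniqueness pattern follows `Literature/Barriers/CriticalPhenomena/RigorousRGSmallParameterHHWPositivity.leibniz_recursion`.
References: FST II, CPAM 51 (1998) §3; BGM 2006 §2.4 [cite: BenfattoGiulianiMastropietro2006].
-/

noncomputable section

namespace Summit.HubbardSuperconductivity.HubbardSuperconductivity.Theorems.C4a

set_option linter.dupNamespace false -- summit = problem name (single-conjunct summit), D-0017

open Real Set Filter Finset
open scoped Topology

/-! ## §1 The pointwise chain of `iteratedDeriv` from local smoothness -/

section Chain

variable {F : Type*} [NormedAddCommGroup F] [NormedSpace ℝ F] {f : ℝ → F} {x : ℝ} {N m : ℕ}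

/-- `C^N` at `x` with `m < N` ⟹ `(f^{(m)})′(x) = f^{(m+1)}(x)` as a `HasDerivAt` statement (local version of Mathlib's
`ContDiff.differentiable_iteratedDeriv`: `C^N` on an open neighbourhood, `iteratedDerivWithin = iteratedDeriv` there). [folklore]
-- adapted from Summits/QuantumFields/BalabanUV/Beta/FP/InverseSymbolDerivN.lean (`hasDerivAt_iteratedDeriv_of_contDiffAt`) -/
theorem hasDerivAt_iteratedDeriv_of_contDiffAt (hf : ContDiffAt ℝ N f x) (hm : m < N) :
    HasDerivAt (iteratedDeriv m f) (iteratedDeriv (m + 1) f x) x := by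
  obtain ⟨u, hu_open, hxu, hfu⟩ := hf.contDiffOn' le_rfl (by simp)
  rw [show insert x Set.univ ∩ u = u by simp] at hfu
  have hdiff : DifferentiableOn ℝ (iteratedDerivWithin m f u) u :=
    hfu.differentiableOn_iteratedDerivWithin (by exact_mod_cast hm) hu_open.uniqueDiffOn
  have hmem : u ∈ 𝓝 x := hu_open.mem_nhds hxu
  have heq : iteratedDerivWithin m f u =ᶠ[𝓝 x] iteratedDeriv m f :=
    Filter.eventuallyEq_of_mem hmem fun y hy => iteratedDerivWithin_of_isOpen hu_open hy
  have hdAt : DifferentiableAt ℝ (iteratedDeriv m f) x :=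
    ((hdiff x hxu).differentiableAt hmem).congr_of_eventuallyEq heq.symm
  rw [iteratedDeriv_succ]
  exact hdAt.hasDerivAt

/-- The same on an open set: `f ∈ C^N(U)`, `U` open, `m < N`, `x ∈ U` ⟹ `HasDerivAt (f^{(m)}) (f^{(m+1)} x) x`. [folklore] -/
theorem hasDerivAt_iteratedDeriv_of_contDiffOn {U : Set ℝ} (hU : IsOpen U) (hf : ContDiffOn ℝ N f U) (hm : m < N) (hx : x ∈ U) :
    HasDerivAt (iteratedDeriv m f) (iteratedDeriv (m + 1) f x) x :=
  hasDerivAt_iteratedDeriv_of_contDiffAt (hf.contDiffAt (hU.mem_nhds hx)) hm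

end Chain

/-! ## §2 The exact Leibniz formula for derivative families on an open window -/

section Leibniz

variable {U : Set ℝ}

/-- **LEIBNIZ FOR FAMILIES ON AN OPEN SET.**  If `A k`, `B k`, `P k : ℝ → ℝ` satisfy `(A k)′ = A (k+1)`, `(B k)′ = B (k+1)`, `(P k)′ = P (k+1)` on the
open set `U` for `k < N`, and `P 0 = A 0 · B 0` on `U`, then for every `k ≤ N` and `x ∈ U`,
`P k x = Σ_{j < k+1} C(k,j) · (A j x · B (k−j) x)`.  (Induction: the defect vanishes on `U`, hence has derivative `0` there; its derivative is the next
defect by Pascal's rule `Finset.sum_choose_succ_mul`; derivatives are unique.) [folklore] -/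
theorem leibniz_family_on (hU : IsOpen U) {A B P : ℕ → ℝ → ℝ} {N : ℕ}
    (hA : ∀ k < N, ∀ x ∈ U, HasDerivAt (A k) (A (k + 1) x) x)
    (hB : ∀ k < N, ∀ x ∈ U, HasDerivAt (B k) (B (k + 1) x) x)
    (hP : ∀ k < N, ∀ x ∈ U, HasDerivAt (P k) (P (k + 1) x) x)
    (h0 : ∀ x ∈ U, P 0 x = A 0 x * B 0 x) :
    ∀ k ≤ N, ∀ x ∈ U, P k x = ∑ j ∈ range (k + 1), (k.choose j : ℝ) * (A j x * B (k - j) x) := by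
  intro k
  induction k with
  | zero => intro _ x hx; simpa using h0 x hx
  | succ k ih =>
    intro hk x hx
    have hk' : k < N := by omega
    -- the defect at rank `k` vanishes on the open set `U` …
    set D : ℝ → ℝ := fun y => P k y - ∑ j ∈ range (k + 1), (k.choose j : ℝ) * (A j y * B (k - j) y) with hD
    have hD0 : ∀ y ∈ U, D y = 0 := fun y hy => by
      rw [hD]; simp only; rw [ih hk'.le y hy]; ring
    -- … so its derivative at `x` vanishes; the derivative is the defect at rank `k+1` by Pascal's rule
    have hderiv : HasDerivAt D (P (k + 1) x - ∑ j ∈ range (k + 1), (k.choose j : ℝ) *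
        (A (j + 1) x * B (k - j) x + A j x * B (k - j + 1) x)) x := by
      refine (hP k hk' x hx).sub (HasDerivAt.fun_sum fun j hj => ?_)
      have hj : j ≤ k := Nat.lt_succ_iff.1 (Finset.mem_range.1 hj)
      exact ((hA j (by omega) x hx).mul (hB (k - j) (by omega) x hx)).const_mul _
    have hzero : HasDerivAt D 0 x :=
      (hasDerivAt_const x (0 : ℝ)).congr_of_eventuallyEq (Filter.eventually_of_mem (hU.mem_nhds hx) fun y hy => hD0 y hy)
    have huniq := hderiv.unique hzero
    rw [Finset.sum_choose_succ_mul (fun i l => A i x * B l x) k]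
    have hsplit : ∑ j ∈ range (k + 1), (k.choose j : ℝ) * (A (j + 1) x * B (k - j) x + A j x * B (k - j + 1) x) =
        ∑ i ∈ range (k + 1), (k.choose i : ℝ) * (A i x * B (k + 1 - i) x) +
          ∑ i ∈ range (k + 1), (k.choose i : ℝ) * (A (i + 1) x * B (k - i) x) := by
      rw [← Finset.sum_add_distrib]
      refine Finset.sum_congr rfl fun i hi => ?_
      have hi' : i ≤ k := Nat.lt_succ_iff.1 (Finset.mem_range.1 hi)
      rw [show k + 1 - i = k - i + 1 by omega]
      ring
    rw [hsplit] at huniq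
    linarith

/-- **EXACT LEIBNIZ FORMULA ON AN OPEN WINDOW**: `f, g ∈ C^N(U)`, `U` open, `k ≤ N`, `x ∈ U` ⟹
`(f·g)^{(k)}(x) = Σ_{j < k+1} C(k,j) · f^{(j)}(x) · g^{(k−j)}(x)`. [folklore] -/
theorem iteratedDeriv_mul_eq_sum_on (hU : IsOpen U) {f g : ℝ → ℝ} {N : ℕ} (hf : ContDiffOn ℝ N f U) (hg : ContDiffOn ℝ N g U) :
    ∀ k ≤ N, ∀ x ∈ U, iteratedDeriv k (fun s => f s * g s) x =
      ∑ j ∈ range (k + 1), (k.choose j : ℝ) * (iteratedDeriv j f x * iteratedDeriv (k - j) g x) := by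
  have hfg : ContDiffOn ℝ N (fun s => f s * g s) U := hf.mul hg
  refine leibniz_family_on hU (A := fun j => iteratedDeriv j f) (B := fun j => iteratedDeriv j g)
    (P := fun j => iteratedDeriv j fun s => f s * g s) (N := N) ?_ ?_ ?_ ?_
  · intro k hk x hx; exact hasDerivAt_iteratedDeriv_of_contDiffOn hU hf hk hx
  · intro k hk x hx; exact hasDerivAt_iteratedDeriv_of_contDiffOn hU hg hk hx
  · intro k hk x hx; exact hasDerivAt_iteratedDeriv_of_contDiffOn hU hfg hk hx
  · intro x _; simp

/-- **ABSOLUTE LEIBNIZ BOUND ON AN OPEN WINDOW**: with `|f^{(j)}(x)| ≤ Fb j`, `|g^{(j)}(x)| ≤ Gb j` (`j ≤ k`),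
`|(f·g)^{(k)}(x)| ≤ Σ_{j < k+1} C(k,j) · Fb j · Gb (k−j)`. [folklore] -/
theorem abs_iteratedDeriv_mul_le_on (hU : IsOpen U) {f g : ℝ → ℝ} {N : ℕ} (hf : ContDiffOn ℝ N f U) (hg : ContDiffOn ℝ N g U)
    {k : ℕ} (hk : k ≤ N) {x : ℝ} (hx : x ∈ U) {Fb Gb : ℕ → ℝ}
    (hFb : ∀ j ≤ k, |iteratedDeriv j f x| ≤ Fb j) (hGb : ∀ j ≤ k, |iteratedDeriv j g x| ≤ Gb j) :
    |iteratedDeriv k (fun s => f s * g s) x| ≤ ∑ j ∈ range (k + 1), (k.choose j : ℝ) * (Fb j * Gb (k - j)) := by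
  rw [iteratedDeriv_mul_eq_sum_on hU hf hg k hk x hx]
  refine (Finset.abs_sum_le_sum_abs _ _).trans (Finset.sum_le_sum fun j hj => ?_)
  have hj : j ≤ k := Nat.lt_succ_iff.1 (Finset.mem_range.1 hj)
  rw [abs_mul, abs_mul, Nat.abs_cast]
  refine mul_le_mul_of_nonneg_left ?_ (Nat.cast_nonneg _)
  exact mul_le_mul (hFb j hj) (hGb (k - j) (by omega)) (abs_nonneg _) ((abs_nonneg _).trans (hFb j hj))

end Leibniz

/-! ## §3 The reciprocal-slope jets from the implicit relation `(1/h)·h ≡ 1` -/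

section Reciprocal

variable {U : Set ℝ} {h : ℝ → ℝ} {N : ℕ}

/-- `h ∈ C^N(U)` nonvanishing on `U` ⟹ `1/h ∈ C^N(U)`. [folklore] -/
theorem contDiffOn_inv_of_ne (hh : ContDiffOn ℝ N h U) (h0 : ∀ x ∈ U, h x ≠ 0) : ContDiffOn ℝ N (fun s => (h s)⁻¹) U :=
  hh.inv h0

/-- **THE IMPLICIT RELATION DIFFERENTIATED**: `h ∈ C^N(U)`, `U` open, `h ≠ 0` on `U`, `1 ≤ k ≤ N`, `x ∈ U` ⟹
`Σ_{j < k+1} C(k,j) · (1/h)^{(j)}(x) · h^{(k−j)}(x) = 0` (Leibniz on `(1/h)·h`, which is `≡ 1` near `x`). [folklore] -/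
theorem sum_choose_iteratedDeriv_inv_mul_eq_zero_on (hU : IsOpen U) (hh : ContDiffOn ℝ N h U) (h0 : ∀ x ∈ U, h x ≠ 0)
    {k : ℕ} (hk1 : 1 ≤ k) (hkN : k ≤ N) {x : ℝ} (hx : x ∈ U) :
    ∑ j ∈ range (k + 1), (k.choose j : ℝ) * (iteratedDeriv j (fun s => (h s)⁻¹) x * iteratedDeriv (k - j) h x) = 0 := by
  rw [← iteratedDeriv_mul_eq_sum_on hU (contDiffOn_inv_of_ne hh h0) hh k hkN x hx]
  have hev : (fun s => (h s)⁻¹ * h s) =ᶠ[𝓝 x] fun _ => (1 : ℝ) :=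
    Filter.eventually_of_mem (hU.mem_nhds hx) fun y hy => inv_mul_cancel₀ (h0 y hy)
  rw [(hev.iteratedDeriv k).eq_of_nhds, iteratedDeriv_const]
  simp [show k ≠ 0 by omega]

/-- **RECIPROCAL JETS SOLVED FROM THE IMPLICIT RELATION**: `h ∈ C^N(U)`, `U` open, slope floor `m ≤ |h|` on `U` (`0 < m`), jet bounds
`|h^{(l)}| ≤ Hb l` on `U` (`1 ≤ l ≤ N`), and a table `R` with `m⁻¹ ≤ R 0` and `m⁻¹ · Σ_{j<k} C(k,j) · R j · Hb (k−j) ≤ R k` (`1 ≤ k ≤ N`) ⟹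
`|(1/h)^{(k)}(x)| ≤ R k` for all `k ≤ N`, `x ∈ U`.  (Strong induction: the rank-`k` relation gives `(1/h)^{(k)}·h = −Σ_{j<k} C(k,j)(1/h)^{(j)} h^{(k−j)}`.) [folklore] -/
theorem abs_iteratedDeriv_inv_le_of_table (hU : IsOpen U) (hh : ContDiffOn ℝ N h U) {m : ℝ} (hm : 0 < m) (hmh : ∀ x ∈ U, m ≤ |h x|)
    {Hb : ℕ → ℝ} (hHb : ∀ l, 1 ≤ l → l ≤ N → ∀ x ∈ U, |iteratedDeriv l h x| ≤ Hb l)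
    {R : ℕ → ℝ} (hR0 : m⁻¹ ≤ R 0) (hR : ∀ k, 1 ≤ k → k ≤ N → m⁻¹ * ∑ j ∈ range k, (k.choose j : ℝ) * R j * Hb (k - j) ≤ R k) :
    ∀ k ≤ N, ∀ x ∈ U, |iteratedDeriv k (fun s => (h s)⁻¹) x| ≤ R k := by
  have h0 : ∀ x ∈ U, h x ≠ 0 := fun x hx h0 => by have := hmh x hx; rw [h0, abs_zero] at this; linarith
  intro k
  induction k using Nat.strong_induction_on with
  | _ k ih =>
    intro hkN x hx
    rcases Nat.eq_zero_or_pos k with rfl | hk1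
    · rw [iteratedDeriv_zero, abs_inv]
      exact (inv_anti₀ hm (hmh x hx)).trans hR0
    · -- the relation at rank `k`, top term split off
      have hrel := sum_choose_iteratedDeriv_inv_mul_eq_zero_on hU hh h0 hk1 hkN hx
      rw [Finset.sum_range_succ, Nat.choose_self, Nat.cast_one, one_mul, Nat.sub_self, iteratedDeriv_zero] at hrel
      -- `|top| · |h x| ≤ Σ_{j<k} C(k,j) · R j · Hb (k−j)`
      have hsum : |∑ j ∈ range k, (k.choose j : ℝ) * (iteratedDeriv j (fun s => (h s)⁻¹) x * iteratedDeriv (k - j) h x)| ≤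
          ∑ j ∈ range k, (k.choose j : ℝ) * R j * Hb (k - j) := by
        refine (Finset.abs_sum_le_sum_abs _ _).trans (Finset.sum_le_sum fun j hj => ?_)
        have hj : j < k := Finset.mem_range.1 hj
        rw [abs_mul, abs_mul, Nat.abs_cast, mul_assoc]
        refine mul_le_mul_of_nonneg_left ?_ (Nat.cast_nonneg _)
        exact mul_le_mul (ih j hj (by omega) x hx) (hHb (k - j) (by omega) (by omega) x hx) (abs_nonneg _)
          ((abs_nonneg _).trans (ih j hj (by omega) x hx))
      have htop : iteratedDeriv k (fun s => (h s)⁻¹) x * h x =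
          -∑ j ∈ range k, (k.choose j : ℝ) * (iteratedDeriv j (fun s => (h s)⁻¹) x * iteratedDeriv (k - j) h x) := by linarith
      have habs : |iteratedDeriv k (fun s => (h s)⁻¹) x| * |h x| ≤ ∑ j ∈ range k, (k.choose j : ℝ) * R j * Hb (k - j) := by
        rw [← abs_mul, htop, abs_neg]; exact hsum
      have hhx : 0 < |h x| := hm.trans_le (hmh x hx)
      have hS : 0 ≤ ∑ j ∈ range k, (k.choose j : ℝ) * R j * Hb (k - j) := le_trans (by positivity) habs
      calc |iteratedDeriv k (fun s => (h s)⁻¹) x|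
          ≤ (∑ j ∈ range k, (k.choose j : ℝ) * R j * Hb (k - j)) / |h x| := by rw [le_div_iff₀ hhx]; exact habs
        _ ≤ (∑ j ∈ range k, (k.choose j : ℝ) * R j * Hb (k - j)) / m := by
            exact div_le_div_of_nonneg_left hS hm (hmh x hx)
        _ = m⁻¹ * ∑ j ∈ range k, (k.choose j : ℝ) * R j * Hb (k - j) := by rw [div_eq_inv_mul]
        _ ≤ R k := hR k hk1 hkN

end Reciprocal

end Summit.HubbardSuperconductivity.HubbardSuperconductivity.Theorems.C4a

end
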